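import Literature.NumberTheory.GaloisCohomology.FiniteSingularComparison
import Literature.NumberTheory.GaloisRepresentations.CyclotomicLevels
import HarnessLib

/-!
# Sakamoto 2024, Theorem 4.4 (1): Kolyvagin systems of core rank one at `p = 3` are free of rank
# one — the case `R = ℤ/3^m`, `K = ℚ` (named fact; cell `b2b-bsdres`, team n1011, row T-a3-F1)

Topic `NumberTheory/GaloisCohomology` (next to the vocabulary files `KolyvaginSystems.lean`,
`FiniteSingularComparison.lean` it is stated over). ONE cite-tagged named fact (`def … : Prop`),
WEAKER than print (special case of the coefficient ring and of the base field; conclusion (1) only),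
never stronger; no theorem, no other definition. Honest framing of the cell (verbatim): research
routes; no claim beyond stated classes; a typed fact is weaker than print or equal, never stronger.

## Source, verbatim

R. Sakamoto, *The theory of Kolyvagin systems for `p = 3`*, J. Théor. Nombres Bordeaux **36** (2024)
919–946. Setting (§2, p. 921): "Let `R` be a zero-dimensional Gorenstein local ring with finite
residue field `𝔽` such that `3^α R = 0` and `char(𝔽) = 3`. … Let `T` be a free `R`-module of finite
rank with a continuous action of `G_K`, unramified at almost all primes of `K`. … we put
`T̄ := T ⊗_R 𝔽`. … (H.1) The `𝔽[G_K]`-module `T̄` is irreducible. (H.2) There is an element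
`τ ∈ G_{H_α}` such that `T/(τ − 1)T ≅ R` as `R`-modules. (H.3) The module `H¹(H_α(T)/K, T̄)`
vanishes, where `H_α(T)` is the field corresponds to the kernel of the homomorphism
`G_{H_α} → Aut(T)`. … (H.SD) the Galois representation `T` is residually self-dual, i.e., there is
an isomorphism `T̄ ≅ T̄^∨(1)` as `𝔽[G_K]`-modules."  (`H_α = H(μ_{3^α}, (𝒪_K^×)^{3^{−α}})`, `H` the
Hilbert class field, p. 920; for `K = ℚ`: `H_α = ℚ(μ_{3^α})`.)  A Selmer structure `𝓕` is "a finite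
set `S(𝓕)` of places of `K` containing the set `S_ram(T) ∪ {𝔮 ∣ 3∞}`" and "a choice of `R`-submodule
`H¹_𝓕(K_𝔮, T) ⊂ H¹(K_𝔮, T)` for each prime `𝔮 ∈ S(𝓕)`" (`H¹_ur` outside); `𝓕̄` is the induced
structure on `T̄`; `𝒫 := {𝔮 ∉ S(𝓕) | 𝔮 is unramified in H_α(T)/K, Fr_𝔮 is conjugate to τ in
Gal(H_α(T)/K)}`.  **Theorem 4.4** (p. 926): "Suppose that • `T` satisfies the hypotheses (H.1),
(H.2), (H.3), and (H.SD) in Section 2, • `𝓕` is cartesian with `χ(𝓕) = 1` and residually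
coisotropic. Then the following claims are valid. (1) The `R`-module `KS₁(T, 𝓕)` is free of rank
`1`. More precisely, for any square-free ideal `d ∈ 𝒩` with `λ^*(d) = 0`, the projection map
`KS₁(T, 𝓕) → H¹_{𝓕(d)}(K, T) ⊗_ℤ G_d` is an isomorphism. (2) For any square-free ideal `d ∈ 𝒩` and
basis `(κ_e)_{e∈𝒩} ∈ KS₁(T, 𝓕)`, we have `I_R(κ_d) = Fitt⁰_R(H¹_{𝓕^*(d)}(K, T^∨(1))^∨)`."
(cartesian: Def. 3.5; core rank `χ(𝓕) := λ(1) − λ^*(1)`: Def. 3.6; residually coisotropic: Def. 3.8;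
`𝓕(d) = 𝓕^1_1(d)`: Def. 3.3 with the transverse condition of Def. 3.2; `KS₁`: Def. 4.1.)

## What is typed, and how it is weaker than print

* Coefficients and base: `R = ℤ/3^m` (`m ≥ 1`; `α = m`, `𝔽 = 𝔽₃`), `K = ℚ` (so `H_α = ℚ(μ_{3^m})`,
  `H_α(T) = ℚ(μ_{3^m}, T)`). `T` = a finite discrete `Γ_ℚ`-module `M` that is free of finite rank
  over `ℤ/3^m` (`Module.Free`, `Module.Finite`); `T̄ = T/3T` with the reduction `red : T ↠ T̄`
  (surjective, kernel `3T`) and Sakamoto's fixed injection `T̄ ↪ T` (§3.1.1, induced by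
  `𝔽 ↪ R`, `1 ↦ 3^{m−1}`) pinned by `incl ∘ red = 3^{m−1}` — both maps are DATA of the tree's
  vocabulary (`SelmerStructure.IsCartesian 𝓕 red incl`, n1011-lit), constrained here to be the
  printed ones.  TODO(general form): `R` any zero-dimensional Gorenstein local `𝔽₃`-algebra, `K`
  any number field (transverse condition via ray class fields, `H_α` with the Hilbert class field
  and unit roots).
* (H.1) as "every `Γ_ℚ`-stable subgroup of `T̄` is `0` or `T̄`"; (H.2) with `τ` fixing `μ_{3^m}`
  (`rootsOfUnityFixer ℚ (3^m)`) and `T/(τ−1)T ≃+ ℤ/3^m` (`cokerSubOne`); (H.3) in the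
  inflation–restriction form "every continuous crossed homomorphism `Γ_ℚ → T̄` vanishing on
  `Γ_{ℚ(μ_{3^m}, T)} = ker ρ ∩ rootsOfUnityFixer` is principal" (`= H¹(Gal(ℚ(μ_{3^m},T)/ℚ), T̄) = 0`,
  that group acting trivially on `T̄`); (H.SD) as a bijective equivariant `θ : T̄ → T̄^∨(1)`
  (`tateDual 3`).
* Local duality enters through a Poitou–Tate family `inv : LocalInvariants ℚ 3` with the four
  properties of the tree's fact `poitouTate_selmerStructure_duality` (the dual structure `𝓕̄^*`,
  `λ^*`, `χ` and "residually coisotropic" are the tree's `dualSelmerStructure`/`lambdaStar`/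
  `HasCoreRank`/`IsResiduallyCoisotropic` relative to `inv`; annihilators do not depend on the
  normalisation of a perfect family).
* `S(𝓕)` = a finite set `S` of places containing the infinite place, the place `3` and the ramified
  places, with `𝓕` unramified outside `S` (`IsUnramifiedOutside`); `𝒫 = frobeniusClassPrimes ρ S τ 3^m`
  (= Sakamoto's `𝒫` for `K = ℚ`, see that definition's docstring); the transverse conditions are
  the cyclotomic ones `H¹(ℚ_ℓ(μ_ℓ)/ℚ_ℓ, T)` (`cyclotomicTransverse`; for `K = ℚ` and `3`-power-torsion
  `T` this is Sakamoto's Def. 3.2 condition — the `3`-primary part sees only the `3`-power layer of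
  `ℚ_ℓ(μ_ℓ)/ℚ_ℓ`).
* **The finite–singular comparison maps.** Sakamoto's `KS₁` is defined with THE canonical
  isomorphisms `φ^{fs}_𝔮 : H¹_ur(K_𝔮,T) ⥲ H¹_{/ur}(K_𝔮,T) ⊗ G_𝔮` (§4, p. 925); the tree's
  `KolyvaginDatum` carries `fs` as a slot in the GENERATOR-FIXED convention of the refereed
  consumer — Kim, AJM 148 (2026) §2.2.2: "Our convention of Kolyvagin systems depends on the
  choice of generators of `Gal(ℚ(μ_ℓ)/ℚ)` for each prime `ℓ` dividing `n`, and it corresponds to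
  the choice of the primitive roots in the definition of Kurihara numbers." — and this fact BINDS
  the slot to the canonical map by the predicate `KolyvaginDatum.HasCanonicalComparison D (3^m) η`
  (`FiniteSingularComparison.lean`: Rubin PCMS Def. 1.9.6 `w(τ̃) = Q(φ̃⁻¹) z(φ̃)` for a FIXED
  generator system `η`; team n1011 referee-1 ruling 2026-08-21, riders (a)/(b)). So nothing is
  asserted about an arbitrary comparison datum. (Alternative binder, also in the tree:
  `D.IsAdmissible` + local freeness, print-equivalent by the rescaling lemma
  `Summit.…GaloisImage.exists_kolyvaginSystems_addEquiv_rescale`; not used here.)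
* Conclusion: (1) only, in the generator-fixed form: `KS₁(T,𝓕)` (`D.kolyvaginSystems 𝓕`) is free of
  rank one over `ℤ/3^m` (`IsFreeRankOneZMod`), and for every level `d ∈ 𝒩` with `λ^*(d) = 0` the
  projection `κ ↦ κ_d` onto `H¹_{𝓕(d)}(ℚ, T)` is bijective (`⊗ G_d` trivialised by `η`).
  (2) (`I_R(κ_d) = Fitt⁰`) is NOT typed (Mathlib has no Fitting ideals; for `R = ℤ/3^m` it is an
  index identity — TODO).

References: [Sakamoto2024] §2 (p. 921), Defs. 3.2, 3.3, 3.5, 3.6, 3.8 (pp. 922–924), Def. 4.1,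
Thm. 4.4 (p. 926), Props. 7.6–7.7; [Kim2022StructureSelmer] §2.1.2, §2.2.2; [Rubin2011] Def. 1.9.6,
Def. 2.2.1; B. Mazur, K. Rubin, Mem. AMS 799 (2004) §3.5.
-/

noncomputable section

open scoped Classical NumberField ContRepresentation
open Field NumberField IsDedekindDomain
open Literature.NumberTheory.GaloisRepresentations Literature.NumberTheory.GaloisRepresentations.DiscreteGaloisModule
  Literature.NumberTheory.GaloisCohomology

namespace Literature.NumberTheory.GaloisCohomology.Sakamoto2024

/-- **Sakamoto 2024, Thm. 4.4 (1), for `R = ℤ/3^m` and `K = ℚ`.** Let `T` be a finite discrete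
`Γ_ℚ`-module, free of finite rank over `ℤ/3^m` (`m ≥ 1`), with reduction `red : T ↠ T̄ = T/3T`
(kernel `3T`) and the fixed injection `incl : T̄ ↪ T`, `incl ∘ red = 3^{m−1}`. Assume (H.1) `T̄` is
an irreducible `Γ_ℚ`-module; (H.2) some `τ ∈ Γ_{ℚ(μ_{3^m})}` has `T/(τ−1)T ≅ ℤ/3^m`; (H.3)
`H¹(ℚ(μ_{3^m}, T)/ℚ, T̄) = 0` (every continuous crossed homomorphism `Γ_ℚ → T̄` vanishing on
`Γ_{ℚ(μ_{3^m},T)}` is principal); (H.SD) `θ : T̄ ⥲ T̄^∨(1)`. Let `𝓕` be a Selmer structure with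
`S(𝓕) = S ∋ ∞, 3, S_ram(T)`, unramified outside `S`, which is cartesian (Def. 3.5), of core rank
`χ(𝓕) = 1` (Def. 3.6) and residually coisotropic (Def. 3.8) — the last two relative to a
Poitou–Tate family `inv` of local invariants. Let the Kolyvagin datum `D` have Sakamoto's primes
`𝒫` (Frobenius conjugate to `τ` in `Gal(ℚ(μ_{3^m},T)/ℚ)`, outside `S`), the cyclotomic transverse
conditions, and THE canonical finite–singular comparison maps for a fixed generator system `η`
(`HasCanonicalComparison`; Kim 2026 §2.2.2: "Our convention of Kolyvagin systems depends on the
choice of generators of `Gal(ℚ(μ_ℓ)/ℚ)` for each prime `ℓ` dividing `n`"). THEN `KS₁(T, 𝓕)` is free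
of rank one over `ℤ/3^m`, and for every level `d ∈ 𝒩` with `λ^*(d) = 0` the projection
`KS₁(T,𝓕) → H¹_{𝓕(d)}(ℚ, T)`, `κ ↦ κ_d`, is bijective. (Conclusion (2) of the theorem and the general
coefficient ring / base field are not typed — weaker than print.)
[cite: Sakamoto2024, Thm. 4.4 (1) (p. 926); §2 (H.1)–(H.3), (H.SD) (p. 921); Defs. 3.5, 3.6, 3.8, 4.1]
[cite: Kim2022StructureSelmer, §2.2.2 (generator-fixed convention)]
[cite: Rubin2011, Def. 1.9.6 (p. 14) and Def. 2.2.1 (p. 18)] -/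
def kolyvaginSystems_freeRankOne_zmod_three_pow : Prop :=
  ∀ (M : Type) [AddCommGroup M] [TopologicalSpace M] [DiscreteTopology M] [Finite M]
    (Mbar : Type) [AddCommGroup Mbar] [TopologicalSpace Mbar] [DiscreteTopology Mbar] [Finite Mbar]
    (m : ℕ) [NeZero m] [Module (ZMod (3 ^ m)) M] [Module.Free (ZMod (3 ^ m)) M]
    [Module.Finite (ZMod (3 ^ m)) M]
    (ρ : DiscreteGaloisModule ℚ M) (ρbar : DiscreteGaloisModule ℚ Mbar)
    (red : ρ.toContRepresentation →ⁱL ρbar.toContRepresentation)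
    (incl : ρbar.toContRepresentation →ⁱL ρ.toContRepresentation)
    (τ : absoluteGaloisGroup ℚ)
    (θ : ρbar.toContRepresentation →ⁱL (ρbar.tateDual 3).toContRepresentation)
    (inv : LocalInvariants ℚ 3)
    (S : Finset (Place ℚ)) (𝓕 : SelmerStructure ρ) (D : KolyvaginDatum ρ)
    (η : (q : HeightOneSpectrum (𝓞 ℚ)) → (ZMod (Ideal.absNorm q.asIdeal))ˣ),
    -- the residual pair is `T ↠ T/3T`, `T/3T ↪ T` with `incl ∘ red = 3^{m-1}`
    Function.Surjective red →
    (∀ x : M, red x = 0 ↔ ∃ y : M, x = (3 : ℤ) • y) →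
    (∀ x : M, incl (red x) = ((3 : ℤ) ^ (m - 1)) • x) →
    -- (H.1)
    (∀ H : AddSubgroup Mbar, (∀ (σ : absoluteGaloisGroup ℚ) (x : Mbar), x ∈ H → ρbar σ x ∈ H) →
      H = ⊥ ∨ H = ⊤) →
    -- (H.2)
    τ ∈ rootsOfUnityFixer ℚ (3 ^ m) → Nonempty (cokerSubOne ρ τ ≃+ ZMod (3 ^ m)) →
    -- (H.3)
    (∀ f : contOneCocycles ρbar.toTopRep,
      (∀ u : absoluteGaloisGroup ℚ, ρ u = 1 → u ∈ rootsOfUnityFixer ℚ (3 ^ m) → f.1 u = 0) →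
        oneCocycleClass ρbar.toTopRep f = 0) →
    -- (H.SD)
    Function.Bijective θ →
    -- the local duality family (Poitou–Tate)
    inv.IsPerfect → inv.SumLocalTermEqZero → inv.UnramifiedOrthogonal → inv.SelmerComplement →
    -- `S(𝓕) = S ⊇ {∞, 3} ∪ S_ram(T)`, `H¹_ur` outside `S`
    (∀ w : InfinitePlace ℚ, (Sum.inl w : Place ℚ) ∈ S) →
    (∀ v : HeightOneSpectrum (𝓞 ℚ), (Sum.inr v : Place ℚ) ∉ S →
      ((3 : ℕ) : 𝓞 ℚ) ∉ v.asIdeal ∧ GaloisRep.IsUnramifiedAt v ρ) →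
    𝓕.IsUnramifiedOutside S →
    -- the hypotheses of Thm. 4.4 on `𝓕`
    𝓕.IsCartesian red incl S →
    LocalInvariants.HasCoreRank inv (𝓕.induced red) 3 1 →
    inv.IsResiduallyCoisotropic (𝓕.induced red) θ S →
    -- the Kolyvagin datum: Sakamoto's `𝒫`, the transverse conditions, THE comparison maps
    D.primes = frobeniusClassPrimes ρ {v | (Sum.inr v : Place ℚ) ∈ S} τ (3 ^ m) →
    D.transverse = cyclotomicTransverse ρ →
    D.HasCanonicalComparison (3 ^ m) η →
    -- conclusion (1)
    KolyvaginSystem.IsFreeRankOneZMod (D.kolyvaginSystems 𝓕) (3 ^ m) ∧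
      ∀ (d : Finset (HeightOneSpectrum (𝓞 ℚ))) (hd : D.IsLevel d),
        LocalInvariants.lambdaStar inv ((D.atLevel 𝓕 d).induced red) 3 = 0 →
        Function.Bijective fun κ : D.kolyvaginSystems 𝓕 =>
          (⟨κ.1 d, ((KolyvaginDatum.mem_kolyvaginSystems_iff D 𝓕 κ.1).mp κ.2).mem_selmerGroup d hd⟩ :
            (D.atLevel 𝓕 d).selmerGroup)

end Literature.NumberTheory.GaloisCohomology.Sakamoto2024

end
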